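import Summits.CriticalPhenomena.PercolationContinuityZ3.Theorems.PercNearOneGluingNoHeavyPcintNawMemZ5M10Check1
import Summits.CriticalPhenomena.PercolationContinuityZ3.Theorems.PercNearOneGluingNoHeavyPcintNawMemZ5M10Check2
import HarnessLib

/-!
# PCINT lane, kernel reduced-state B2r certificate `Z5M10` (d = 5, memory τ = 10, 798 state classes): the theorem

Cell `prim-pcint`, seat `prim-pcint-1` (gen 5); memo `run/shared/lean/prim/pcint/INTERVAL-PLAN.md` §16 ("checker for the reduced-state
automata").  Does NOT build on p205010.  Data for `NawK.le_siteCriticalProb_of_checkRows` (`…PcintNawRandMemKernelCert`): `p = 12600/100000`,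
`q̄ = 98515/100000` (`q̄^9·100000^9 ≥ (100000-12600)·100000^8`), `κ̄ = (100000+98515)/(2·100000)`, `λ = 99999/100000`; Collatz–Wielandt weights (scale 10⁹) from a
power iteration, exact off-line max row ratio 0.9995005449 < λ.  Generated by gen5/gen_lean.py (pcint-1 folder); the kernel re-checks every row.
-/

namespace Summit.CriticalPhenomena.PercolationContinuityZ3.Theorems.Pcint

open Literature.Probability.Percolation Literature.Probability.LatticeModels

/-- Every row of the certificate passes. [folklore] -/
theorem NawMemZ5M10.all_rows : WinK.allRange (NawK.checkRow 10 5 798 12600 98515 100000 99999 100000 NawMemZ5M10.syms NawMemZ5M10.tree) 0 798 = true := (WinK.allRange_split NawMemZ5M10.file_1 NawMemZ5M10.file_2)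

/-- **`p_c^site(ℤ⁵) ≥ 0.1260`** (kernel-checked reduced-state B2r certificate: memory-`10` dangerous-set automaton,
798 state classes, `decide +kernel` only). [folklore] -/
theorem siteCriticalProb_Z5_ge_0126 : (0.126 : ℝ) ≤ siteCriticalProb (zdGraph 5) 0 := by
  have h := NawK.le_siteCriticalProb_of_checkRows (d := 5) (τ := 10) (N := 798) (pn := 12600) (Q := 98515) (D := 100000)
    (lamN := 99999) (lamD := 100000) (syms := NawMemZ5M10.syms) (t := NawMemZ5M10.tree) (by norm_num)
    (fun c => NawK.symOfTab 5 (NawMemZ5M10.syms.getD c [])) (NawK.syms_spec_of_valid NawMemZ5M10.syms_valid)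
    (fun i hi => WinK.of_allRange NawMemZ5M10.all_rows (Nat.zero_le i) hi)
    (by norm_num) (by decide +kernel) (by norm_num) (by norm_num) (by norm_num) (by norm_num) (by norm_num)
  have e : ((12600 : ℕ) : ℝ) / ((100000 : ℕ) : ℝ) = (0.126 : ℝ) := by norm_num
  rw [e] at h
  exact h

end Summit.CriticalPhenomena.PercolationContinuityZ3.Theorems.Pcint
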